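import Summits.HubbardSuperconductivity.HubbardSuperconductivity.Theorems.BalabanIRBirComplexStableXYRCovarianceFRDMatrix
import Literature.Analysis.Matrix.FiniteRangeDecompositionVolumeUniform
import HarnessLib

/-!
# Crux `BirComplexStableXYR` (stmt-HubbardSuperconductivity-14845): MILESTONE M1, part 2 —
# the finite-range decomposition of the engine's real reference covariance, volume-uniformly

Support file (prover seat 1, route BalabanIR) for the restated engine
`…Theses.BalabanIR.BirComplexStableXYR`, line `log-concave-core-bounded-phase`, blueprint milestone M1
(`Lines/log-concave-core-bounded-phase.md` §3): "finite-range decomposition of the REAL covariance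
`(KQ)⁻¹` on `(ℤ/L)²×ℤ/M` respecting translations, (R), (P), for a general positive finite-range form
`Q ≥ c₀Δ`".

Continuation of `…CovarianceFRDMatrix.lean` (part 1: the Hessian matrix `H` of
`Q_c(u) = Re(−Σ_s Σ_n c_n (n·(u∘sh s))²)`, its symmetry, translation invariance, locality / finite
range, positivity and the bound `H ≤ Λ_c·1`, `Λ_c := 2·normA(c)·r³`).  This file proves:

* `cfrd_symbol_ge` — symbol domination `c₀ · Σ_i (2 − 2Re ψ(E_i)) ≤ Re σ_H(ψ)` for every character `ψ`
  of the space-time torus (from `gaussianCoercive` applied to `Re ψ`, `Im ψ`);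
* the characters of `(ℤ/L)² × ℤ/M` are determined by the three unit steps (`cfrd_addChar_ext`);
* **`birHessian_covarianceFRD`** (registered stub of this seat on the crux item): with
  `A := (4/Λ_c)•H` (so `0 ≤ A ≤ 4`) the dyadic Fejér pieces
  `C_N := frdPiece A N` (`Literature.Analysis.Matrix`) give, for every `J`,
  `H · Σ_{N<J} (4/Λ_c)•C_N + R_J = 1` EXACTLY, each `C_N` positive semidefinite, translation
  invariant, a polynomial of degree `< 2^{N+1}` in `H` (hence of range `< 2^{N+1}(r−1)` window steps
  and commuting with every symmetry of `H`: (R), (P), lattice rotations — `commute_frdPiece`), and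
  VOLUME-UNIFORMLY SINGLE-SCALE:
  `|C_N(x,y)| ≤ (27/4 + π⁴Λ_c²/(16c₀²))·2^{−N}` for all `x,y`, all `2^N ≤ L`, `2^N ≤ M`.
  This is [BrydgesGuadagniMitter2004, Thm. 1.1] / [Bauerschmidt2013, Thm. 1.2] for the engine's
  general (non-Markovian, merely coercive) finite-range form, by pure polynomial calculus.

No definitions; sorry-free. [folklore]
-/

noncomputable section

namespace Summit.HubbardSuperconductivity.HubbardSuperconductivity.Theorems

set_option linter.dupNamespace false -- summit = problem name (single-conjunct summit), D-0017

open scoped BigOperators Matrix ComplexConjugate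
open Complex Summit.HubbardSuperconductivity.BirComplexStableXYNegative
open Literature.Probability.LatticeModels Literature.Analysis.Matrix Literature.Analysis.Fourier

section CovarianceFRD

variable {r : ℕ} {L M : ℕ} [NeZero L] [NeZero M]

-- The window linear form `a_{(s,n)}(j) = Σ_w n_w [sh s w = j]` (local abbreviation).
set_option quotPrecheck false in
local notation "aform[" L' "," M' "](" s "," n "," j ")" =>
  ∑ w, (((n w : ℤ) : ℝ) * (if sh L' M' s w = j then (1 : ℝ) else 0))

-- The inline Hessian matrix of `Q_c` (local abbreviation).
set_option quotPrecheck false in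
local notation "Hm[" c' "," L' "," M' "]" => (Matrix.of fun i j : Λ L' M' =>
  (-(∑ k : Λ L' M' × ↥((c' : Table _).support),
    (c' : Table _) k.2 * ((aform[L',M'](k.1, k.2.1, i) : ℝ) : ℂ)
      * ((aform[L',M'](k.1, k.2.1, j) : ℝ) : ℂ))).re)

/-! ## Characters of the space-time torus -/

/-- Characters of `(ℤ/L)² × ℤ/M` are determined by their values on the three unit steps. [folklore] -/
theorem cfrd_addChar_ext (ψ φ : AddChar (Λ L M) ℂ)
    (h : ∀ i : Fin 3, ψ ((![((![1, 0] : TorusSite 2 L), (0 : ZMod M)), (![0, 1], 0), (0, 1)]) i)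
      = φ ((![((![1, 0] : TorusSite 2 L), (0 : ZMod M)), (![0, 1], 0), (0, 1)]) i)) : ψ = φ := by
  have h0 : ψ (![1, 0], 0) = φ (![1, 0], 0) := by simpa using h 0
  have h1 : ψ (![0, 1], 0) = φ (![0, 1], 0) := by simpa using h 1
  have h2 : ψ (0, 1) = φ (0, 1) := by simpa using h 2
  ext x
  rw [birLat_decompose x]
  simp only [AddChar.map_add_eq_mul, AddChar.map_nsmul_eq_pow, AddChar.map_zero_eq_one, h0, h1, h2]

omit [NeZero L] [NeZero M] in
/-- The unit steps have order dividing `L`, `L`, `M`. [folklore] -/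
theorem cfrd_order (i : Fin 3) :
    ((![L, L, M] : Fin 3 → ℕ) i) • ((![((![1, 0] : TorusSite 2 L), (0 : ZMod M)), (![0, 1], 0), (0, 1)]) i)
      = 0 := by
  fin_cases i
  · refine Prod.ext ?_ ?_
    · funext k; fin_cases k <;> simp [Prod.smul_mk]
    · simp [Prod.smul_mk]
  · refine Prod.ext ?_ ?_
    · funext k; fin_cases k <;> simp [Prod.smul_mk]
    · simp [Prod.smul_mk]
  · refine Prod.ext ?_ ?_
    · funext k; fin_cases k <;> simp [Prod.smul_mk]
    · simp [Prod.smul_mk]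

/-- `|Λ| = L·L·M`. [folklore] -/
theorem cfrd_card : ∏ i : Fin 3, (((![L, L, M] : Fin 3 → ℕ) i : ℕ) : ℝ) ≤ Fintype.card (Λ L M) := by
  rw [Fin.prod_univ_three]
  change ((L : ℕ) : ℝ) * ((L : ℕ) : ℝ) * ((M : ℕ) : ℝ) ≤ _
  rw [Fintype.card_prod, birLat_card_slice, ZMod.card]
  push_cast
  nlinarith

omit [NeZero L] [NeZero M] in
/-- `Σ_{i<3} f(E_i) = f(E₁) + f(E₂) + f(E₃)` for the three unit steps. [folklore] -/
theorem cfrd_sum_three (f : Λ L M → ℝ) :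
    ∑ i : Fin 3, f ((![((![1, 0] : TorusSite 2 L), (0 : ZMod M)), (![0, 1], 0), (0, 1)]) i)
      = f (![1, 0], 0) + f (![0, 1], 0) + f (0, 1) := by
  rw [Fin.sum_univ_three]
  rfl

/-! ## Symbol domination -/

/-- `(Re ψ(s) − Re ψ(s+E))² + (Im ψ(s) − Im ψ(s+E))² = 2 − 2 Re ψ(E)`. [folklore] -/
theorem cfrd_char_step_sq (ψ : AddChar (Λ L M) ℂ) (s E : Λ L M) :
    ((ψ s).re - (ψ (s + E)).re) ^ 2 + ((ψ s).im - (ψ (s + E)).im) ^ 2 = 2 - 2 * (ψ E).re := by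
  have hn : ∀ x, (ψ x).re ^ 2 + (ψ x).im ^ 2 = 1 := by
    intro x
    have h := AddChar.norm_apply ψ x
    have h2 : ‖ψ x‖ ^ 2 = 1 := by rw [h]; norm_num
    rw [Complex.sq_norm, Complex.normSq_apply] at h2
    nlinarith
  rw [AddChar.map_add_eq_mul]
  have hs := hn s
  have hE := hn E
  simp only [Complex.mul_re, Complex.mul_im]
  nlinarith [hs, hE]

/-- **Symbol domination**: for every character `ψ` of the space-time torus,
`c₀ · Σ_i (2 − 2 Re ψ(E_i)) ≤ Re σ_H(ψ)`. [folklore] -/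
theorem cfrd_symbol_ge (hr : 2 ≤ r) (c : Table r) {c₀ : ℝ} (hc₀ : 0 < c₀)
    (hN : c.sum (fun _ a => a) = 0)
    (hC : ∀ φ : W r → ℝ, c₀ * ∑ w, ∑ w', (1 - Real.cos (φ w - φ w')) ≤ (genF c φ).re)
    (ψ : AddChar (Λ L M) ℂ) :
    c₀ * ∑ i : Fin 3, (2 - 2 * (ψ ((![((![1, 0] : TorusSite 2 L), (0 : ZMod M)), (![0, 1], 0), (0, 1)]) i)).re)
      ≤ (symbol (Hm[c,L,M]) ψ).re := by
  have htrans := cfrd_translationInvariant (L := L) (M := M) c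
  -- `|Λ| Re σ = Q(Re ψ) + Q(Im ψ)`
  have h1 := star_dotProduct_mulVec_addChar ψ htrans
  have h2 := re_star_dotProduct_map_mulVec (Hm[c,L,M]) (ψ : Λ L M → ℂ)
  have hcard : (0 : ℝ) < Fintype.card (Λ L M) := Nat.cast_pos.mpr Fintype.card_pos
  have hre : (Fintype.card (Λ L M) : ℝ) * (symbol (Hm[c,L,M]) ψ).re
      = (fun x => ((ψ : Λ L M → ℂ) x).re) ⬝ᵥ (Hm[c,L,M] *ᵥ fun x => ((ψ : Λ L M → ℂ) x).re)
        + (fun x => ((ψ : Λ L M → ℂ) x).im) ⬝ᵥ (Hm[c,L,M] *ᵥ fun x => ((ψ : Λ L M → ℂ) x).im) := by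
    rw [← h2, h1]
    simp only [Complex.mul_re, Complex.natCast_re, Complex.natCast_im, zero_mul, sub_zero]
  -- coercivity on the real and imaginary parts
  have hq1 := gaussianCoercive hr c hc₀ hN hC L M (fun x => ((ψ : Λ L M → ℂ) x).re)
  have hq2 := gaussianCoercive hr c hc₀ hN hC L M (fun x => ((ψ : Λ L M → ℂ) x).im)
  rw [cfrd_form_eq c (fun x => ((ψ : Λ L M → ℂ) x).re)] at hq1
  rw [cfrd_form_eq c (fun x => ((ψ : Λ L M → ℂ) x).im)] at hq2
  -- the Dirichlet forms of `Re ψ`, `Im ψ` sum to `|Λ| Σ_i (2 − 2Re ψ(E_i))`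
  have hD : c₀ * ∑ s : Λ L M, ((((ψ : Λ L M → ℂ) s).re - ((ψ : Λ L M → ℂ) (s + (![1, 0], 0))).re) ^ 2
        + (((ψ : Λ L M → ℂ) s).re - ((ψ : Λ L M → ℂ) (s + (![0, 1], 0))).re) ^ 2
        + (((ψ : Λ L M → ℂ) s).re - ((ψ : Λ L M → ℂ) (s + (0, 1))).re) ^ 2)
      + c₀ * ∑ s : Λ L M, ((((ψ : Λ L M → ℂ) s).im - ((ψ : Λ L M → ℂ) (s + (![1, 0], 0))).im) ^ 2
        + (((ψ : Λ L M → ℂ) s).im - ((ψ : Λ L M → ℂ) (s + (![0, 1], 0))).im) ^ 2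
        + (((ψ : Λ L M → ℂ) s).im - ((ψ : Λ L M → ℂ) (s + (0, 1))).im) ^ 2)
      = (Fintype.card (Λ L M) : ℝ) * (c₀ * ∑ i : Fin 3,
          (2 - 2 * (ψ ((![((![1, 0] : TorusSite 2 L), (0 : ZMod M)), (![0, 1], 0), (0, 1)]) i)).re)) := by
    rw [← mul_add, ← Finset.sum_add_distrib]
    have hstep : ∀ s : Λ L M,
        ((((ψ : Λ L M → ℂ) s).re - ((ψ : Λ L M → ℂ) (s + (![1, 0], 0))).re) ^ 2
          + (((ψ : Λ L M → ℂ) s).re - ((ψ : Λ L M → ℂ) (s + (![0, 1], 0))).re) ^ 2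
          + (((ψ : Λ L M → ℂ) s).re - ((ψ : Λ L M → ℂ) (s + (0, 1))).re) ^ 2)
        + ((((ψ : Λ L M → ℂ) s).im - ((ψ : Λ L M → ℂ) (s + (![1, 0], 0))).im) ^ 2
          + (((ψ : Λ L M → ℂ) s).im - ((ψ : Λ L M → ℂ) (s + (![0, 1], 0))).im) ^ 2
          + (((ψ : Λ L M → ℂ) s).im - ((ψ : Λ L M → ℂ) (s + (0, 1))).im) ^ 2)
        = ∑ i : Fin 3, (2 - 2 * (ψ ((![((![1, 0] : TorusSite 2 L), (0 : ZMod M)),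
            (![0, 1], 0), (0, 1)]) i)).re) := by
      intro s
      rw [cfrd_sum_three (fun E => 2 - 2 * (ψ E).re)]
      have e1 := cfrd_char_step_sq ψ s (![1, 0], 0)
      have e2 := cfrd_char_step_sq ψ s (![0, 1], 0)
      have e3 := cfrd_char_step_sq ψ s (0, 1)
      linarith
    simp_rw [hstep]
    rw [Finset.sum_const, Finset.card_univ, nsmul_eq_mul]
    ring
  have key : (Fintype.card (Λ L M) : ℝ) * (c₀ * ∑ i : Fin 3,
      (2 - 2 * (ψ ((![((![1, 0] : TorusSite 2 L), (0 : ZMod M)), (![0, 1], 0), (0, 1)]) i)).re))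
      ≤ (Fintype.card (Λ L M) : ℝ) * (symbol (Hm[c,L,M]) ψ).re := by
    rw [← hD, hre]
    exact add_le_add hq1 hq2
  exact le_of_mul_le_mul_left key hcard

/-! ## The finite-range decomposition of the covariance (registered stub) -/

/-- `normA(c) > 0` under (C) with `c₀ > 0`, `r ≥ 2` (the table is not zero). [folklore] -/
theorem cfrd_normA_pos (hr : 2 ≤ r) (c : Table r) {c₀ : ℝ} (hc₀ : 0 < c₀)
    (hC : ∀ φ : W r → ℝ, c₀ * ∑ w, ∑ w', (1 - Real.cos (φ w - φ w')) ≤ (genF c φ).re) :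
    0 < normA c := by
  -- a non-constant window configuration
  set w₀ : W r := (⟨0, by omega⟩, ⟨0, by omega⟩, ⟨0, by omega⟩) with hw₀
  set w₁ : W r := (⟨1, by omega⟩, ⟨0, by omega⟩, ⟨0, by omega⟩) with hw₁
  have hne : w₀ ≠ w₁ := by simp [hw₀, hw₁]
  set φ : W r → ℝ := fun w => if w = w₀ then Real.pi else 0 with hφ
  have hpos : 0 < ∑ w, ∑ w', (1 - Real.cos (φ w - φ w')) := by
    have hterm : ∀ w w', 0 ≤ 1 - Real.cos (φ w - φ w') := fun w w' => by
      linarith [Real.cos_le_one (φ w - φ w')]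
    have hφ0 : φ w₀ = Real.pi := by simp [hφ]
    have hφ1 : φ w₁ = 0 := by simp [hφ, hne.symm]
    have h01 : 1 - Real.cos (φ w₀ - φ w₁) = 2 := by
      rw [hφ0, hφ1, sub_zero, Real.cos_pi]; norm_num
    calc (0 : ℝ) < 2 := by norm_num
      _ = 1 - Real.cos (φ w₀ - φ w₁) := h01.symm
      _ ≤ ∑ w', (1 - Real.cos (φ w₀ - φ w')) :=
          Finset.single_le_sum (fun w' _ => hterm w₀ w') (Finset.mem_univ w₁)
      _ ≤ ∑ w, ∑ w', (1 - Real.cos (φ w - φ w')) :=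
          Finset.single_le_sum (fun w _ => Finset.sum_nonneg fun w' _ => hterm w w') (Finset.mem_univ w₀)
  have hF : (genF c φ).re ≤ normA c := by
    refine (Complex.re_le_norm _).trans ?_
    unfold genF normA
    rw [Finsupp.sum, Finsupp.sum]
    refine (norm_sum_le _ _).trans (Finset.sum_le_sum fun n _ => ?_)
    rw [norm_mul, Complex.norm_exp_I_mul_ofReal, mul_one]
    have : (1 : ℝ) ≤ Real.exp (∑ w, |(n w : ℝ)|) :=
      Real.one_le_exp (Finset.sum_nonneg fun w _ => abs_nonneg _)
    nlinarith [norm_nonneg (c n)]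
  have h1 := hC φ
  have h2 := mul_pos hc₀ hpos
  linarith

/-- **MILESTONE M1 — the finite-range decomposition of the engine's real reference covariance,
volume-uniformly (registered stub `birHessian_covarianceFRD` of prover seat 1 on crux 2R).**
For a table with (N) and (C) (`c₀ > 0`, `r ≥ 2`), every torus `(ℤ/L)²×ℤ/M` and every scale `N` with
`2^N ≤ L`, `2^N ≤ M`: writing `H` for the matrix of `Q_c` (`uᵀHu = Re(−Σ_s Σ_n c_n (n·(u∘sh s))²)`,
first conjunct), `Λ_c := 2·normA(c)·r³` and `A := (4/Λ_c)•H`, the dyadic Fejér pieces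
`C_N := frdPiece A N` satisfy: the EXACT identity `H·Σ_{N'<J}(4/Λ_c)•C_{N'} + R_J = 1` for every `J`;
`C_N` is positive semidefinite and translation invariant; and the VOLUME-UNIFORM single-scale bound
`|C_N(x,y)| ≤ (27/4 + π⁴Λ_c²/(16 c₀²))·2^{−N}`. [folklore] -/
theorem birHessian_covarianceFRD : ∀ (r : ℕ) (c : Table r) (c₀ : ℝ), 2 ≤ r → 0 < c₀ → c.sum (fun _ a => a) = 0 → (∀ φ : W r → ℝ, c₀ * ∑ w, ∑ w', (1 - Real.cos (φ w - φ w')) ≤ (genF c φ).re) → ∀ (L M : ℕ) [NeZero L] [NeZero M] (N : ℕ), 2 ^ N ≤ L → 2 ^ N ≤ M → (∀ u : Λ L M → ℝ, (-∑ s : Λ L M, c.sum (fun n a => a * (((∑ w, (n w : ℝ) * u (sh L M s w)) ^ 2 : ℝ) : ℂ))).re = u ⬝ᵥ ((Matrix.of fun i j : Λ L M => (-(∑ k : Λ L M × ↥c.support, c k.2 * ((∑ w, ((k.2 : Freq r) w : ℝ) * (if sh L M k.1 w = i then (1 : ℝ) else 0) : ℝ) : ℂ) * ((∑ w, ((k.2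 : Freq r) w : ℝ) * (if sh L M k.1 w = j then (1 : ℝ) else 0) : ℝ) : ℂ))).re) *ᵥ u)) ∧ (∀ J : ℕ, (Matrix.of fun i j : Λ L M => (-(∑ k : Λ L M × ↥c.support, c k.2 * ((∑ w, ((k.2 : Freq r) w : ℝ) * (if sh L M k.1 w = i then (1 : ℝ) else 0) : ℝ) : ℂ) * ((∑ w, ((k.2 : Freq r) w : ℝ) * (if sh L M k.1 w = j then (1 : ℝ) else 0) : ℝ) : ℂ))).re) * (∑ N' ∈ Finset.range J, (4 / (2 * normA c * (r : ℝ) ^ 3)) • Literature.Analysis.Matrix.frdPiece ((4 / (2 * normA c * (r : ℝ) ^ 3)) • (Matrix.of fun i j : Λ L M => (-(∑ k : Λ L M × ↥c.support, c k.2 * ((∑ w, ((k.2 : Freq r) w : ℝ) * (if sh L M k.1 w = i then (1 : ℝ) else 0) : ℝ) : ℂ) * ((∑ w, ((k.2 : Freq r) w : ℝ) * (if sh L M k.1 w = j then (1 : ℝ) else 0) : ℝ) : ℂ))).re)) N') + Literature.Analysis.Matrix.frdRemainder ((4 / (2 * normA c * (r : ℝ) ^ 3)) • (Matrix.of fun i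 j : Λ L M => (-(∑ k : Λ L M × ↥c.support, c k.2 * ((∑ w, ((k.2 : Freq r) w : ℝ) * (if sh L M k.1 w = i then (1 : ℝ) else 0) : ℝ) : ℂ) * ((∑ w, ((k.2 : Freq r) w : ℝ) * (if sh L M k.1 w = j then (1 : ℝ) else 0) : ℝ) : ℂ))).re)) J = 1) ∧ (Literature.Analysis.Matrix.frdPiece ((4 / (2 * normA c * (r : ℝ) ^ 3)) • (Matrix.of fun i j : Λ L M => (-(∑ k : Λ L M × ↥c.support, c k.2 * ((∑ w, ((k.2 : Freq r) w : ℝ) * (if sh L M k.1 w = i then (1 : ℝ) else 0) : ℝ) : ℂ) * ((∑ w, ((k.2 : Freq r) w : ℝ) * (if sh L M k.1 w = j then (1 : ℝ) else 0) : ℝ) : ℂ))).re)) N).PosSemidef ∧ Literature.Analysis.Fourier.IsTranslationInvariant (Literature.Analysis.Matrix.frdPiece ((4 / (2 * normA c * (r : ℝ) ^ 3)) • (Matrix.of fun i j : Λ L M => (-(∑ k : Λ L M × ↥c.support, c k.2 * ((∑ w, ((k.2 : Freq r) w : ℝ) * (if sh L M k.1 w = i then (1 : ℝ) else 0) : ℝ)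 : ℂ) * ((∑ w, ((k.2 : Freq r) w : ℝ) * (if sh L M k.1 w = j then (1 : ℝ) else 0) : ℝ) : ℂ))).re)) N) ∧ ∀ x y : Λ L M, |Literature.Analysis.Matrix.frdPiece ((4 / (2 * normA c * (r : ℝ) ^ 3)) • (Matrix.of fun i j : Λ L M => (-(∑ k : Λ L M × ↥c.support, c k.2 * ((∑ w, ((k.2 : Freq r) w : ℝ) * (if sh L M k.1 w = i then (1 : ℝ) else 0) : ℝ) : ℂ) * ((∑ w, ((k.2 : Freq r) w : ℝ) * (if sh L M k.1 w = j then (1 : ℝ) else 0) : ℝ) : ℂ))).re)) N x y| ≤ (27 / 4 + Real.pi ^ 4 * (2 * normA c * (r : ℝ) ^ 3) ^ 2 / (16 * c₀ ^ 2)) / 2 ^ N := by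
  intro r c c₀ hr hc₀ hN hC L M _ _ N hL hM
  -- abbreviations
  set H : Matrix (Λ L M) (Λ L M) ℝ := Hm[c,L,M] with hHdef
  set Λc : ℝ := 2 * normA c * (r : ℝ) ^ 3 with hΛc
  have hnA := cfrd_normA_pos hr c hc₀ hC
  have hr0 : (0 : ℝ) < r := by exact_mod_cast (show 0 < r by omega)
  have hΛpos : 0 < Λc := by rw [hΛc]; positivity
  set A : Matrix (Λ L M) (Λ L M) ℝ := (4 / Λc) • H with hAdef
  -- the matrix facts
  have hHherm : H.IsHermitian := cfrd_isHermitian c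
  have hHti : IsTranslationInvariant H := cfrd_translationInvariant c
  have hHpsd : H.PosSemidef := cfrd_posSemidef hr c hc₀ hN hC
  have hHle : (Λc • (1 : Matrix (Λ L M) (Λ L M) ℝ) - H).PosSemidef := cfrd_le_smul_one c
  have h4Λ : 0 ≤ 4 / Λc := by positivity
  have hAherm : A.IsHermitian := hHherm.smul (IsSelfAdjoint.all _)
  have hAti : IsTranslationInvariant A := hHti.smul _
  have hApsd : A.PosSemidef := hHpsd.smul h4Λ
  have hA4 : ((4 : ℝ) • (1 : Matrix (Λ L M) (Λ L M) ℝ) - A).PosSemidef := by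
    have : (4 : ℝ) • (1 : Matrix (Λ L M) (Λ L M) ℝ) - A = (4 / Λc) • (Λc • (1 : Matrix (Λ L M) (Λ L M) ℝ) - H) := by
      rw [hAdef, smul_sub, smul_smul, div_mul_cancel₀ _ hΛpos.ne']
    rw [this]
    exact hHle.smul h4Λ
  -- symbol domination for `A` with constant `4c₀/Λc`
  have hcoer : ∀ ψ : AddChar (Λ L M) ℂ, 4 * c₀ / Λc * ∑ i : Fin 3,
      (2 - 2 * (ψ ((![((![1, 0] : TorusSite 2 L), (0 : ZMod M)), (![0, 1], 0), (0, 1)]) i)).re)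
        ≤ (symbol A ψ).re := by
    intro ψ
    have h := cfrd_symbol_ge hr c hc₀ hN hC ψ
    rw [hAdef, symbol_smul, Complex.mul_re, Complex.ofReal_re, Complex.ofReal_im, zero_mul, sub_zero]
    calc 4 * c₀ / Λc * ∑ i : Fin 3,
          (2 - 2 * (ψ ((![((![1, 0] : TorusSite 2 L), (0 : ZMod M)), (![0, 1], 0), (0, 1)]) i)).re)
        = 4 / Λc * (c₀ * ∑ i : Fin 3,
          (2 - 2 * (ψ ((![((![1, 0] : TorusSite 2 L), (0 : ZMod M)), (![0, 1], 0), (0, 1)]) i)).re)) := by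
            ring
      _ ≤ 4 / Λc * (symbol H ψ).re := mul_le_mul_of_nonneg_left h h4Λ
  have hc₀' : 0 < 4 * c₀ / Λc := by positivity
  have hLN : ∀ i : Fin 3, 2 ^ N ≤ ((![L, L, M] : Fin 3 → ℕ) i) := by
    intro i; fin_cases i <;> simp [hL, hM]
  refine ⟨fun u => cfrd_form_eq c u, fun J => ?_, posSemidef_frdPiece hAherm N,
    (IsTranslationInvariant.one.sub (hAti.smul _)).aeval _ |>.pow 2 |>.smul _, fun x y => ?_⟩
  · -- the exact identity, from `frd_identity` for `A = (4/Λc)•H`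
    have hid := frd_identity A J
    have hAS : A * ∑ N' ∈ Finset.range J, frdPiece A N'
        = H * ∑ N' ∈ Finset.range J, (4 / Λc) • frdPiece A N' := by
      rw [← Finset.smul_sum, mul_smul_comm, ← smul_mul_assoc, hAdef]
    rw [hAS] at hid
    exact hid
  · have hb := abs_frdPiece_apply_le_inv_two_pow
      (![((![1, 0] : TorusSite 2 L), (0 : ZMod M)), (![0, 1], 0), (0, 1)]) (![L, L, M])
      (fun i => cfrd_order i) (fun ψ φ h => cfrd_addChar_ext ψ φ h) cfrd_card
      hAti hAherm hApsd hA4 hc₀' hcoer N hLN x y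
    have hconst : Real.pi ^ 4 / (4 * c₀ / Λc) ^ 2 = Real.pi ^ 4 * Λc ^ 2 / (16 * c₀ ^ 2) := by
      field_simp
      ring
    rw [hconst] at hb
    exact hb

end CovarianceFRD

end Summit.HubbardSuperconductivity.HubbardSuperconductivity.Theorems

end
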